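import Literature.NumberTheory.Transcendental.KZLogCalculusProofs
import Literature.NumberTheory.Transcendental.KZDominatedFamilyRelations
import Literature.NumberTheory.Transcendental.KZProductIdeal
import Literature.NumberTheory.Transcendental.KZMellinFibres

/-!
# `NormalFormPrinciple` (stmt-KontsevichZagierPeriods-3869), line `SketchIdeator1` — the leaf
# `stub_boxRigidity` on the level-one box tower: integrating out the merged coordinate (rule 3)

Registered sub-goal `band_sub_levelOne_dim` of the LEVEL-ONE BOX TOWER (lead file `…LevelOneTower`).
With `w` spectator coordinates `u = Fin.init (Fin.init z) ∈ (0,1)ʷ`, `b < a` and `c ∈ ℚ`, the band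
representation `R = [T, g]`, `T = {init z ∈ (0,1)^{w+1}, 0 ≤ z_last ≤ y}`
(`y = z (castSucc (last w))`), `g = c uᵉ y^{a−b−1} z_last^b/(1 − (∏ u) z_last)`, and the
representation `N₁ = [(0,1)^{w+1}, (c/(a−b)) uᵉ sᵇ (1 − s^{a−b})/(1 − ∏ x)]` (`u = init x`,
`s = x (last w)`) differ by a relation of the Kontsevich–Zagier calculus. Chain of moves (the
dimension-two template is `…LevelOneTriangleSubDimOne`):

1. (rule 2) swap the last two coordinates (`KZ.of_sub_of_reindex_mem_relations`): the domain
   becomes `{u ∈ (0,1)ʷ, 0 < z_last < 1, 0 ≤ s ≤ z_last}` (`s = z (castSucc (last w))`) and the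
   integrand `h = c uᵉ z_last^{a−b−1} sᵇ/(1 − (∏ u) s)`;
2. (rule 1) null adjustment: the swapped domain and the closed-fibre band
   `B₂ = {init z ∈ (0,1)^{w+1}, s ≤ z_last ≤ 1}` over the base `(0,1)^{w+1}` both contain their
   (`ℚ`-semialgebraic) intersection `W` up to the null hyperplanes `{s = 0}`, `{z_last = 1}`
   (`KZ.IntegralRep.of_sub_of_restrict_mem_relations`, `KZ.of_sub_of_mem_relations_of_eqOn`);
3. (rule 3) ONE Newton–Leibniz move along `z_last ∈ [s, 1]` over `(0,1)^{w+1}` with the primitive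
   `F = (c/(a−b)) uᵉ z_last^{a−b} sᵇ/(1 − (∏ u) s)`, `∂F/∂z_last = h`, and
   `F(x, 1) − F(x, s) = (c/(a−b)) uᵉ sᵇ (1 − s^{a−b})/(1 − ∏ x)` (`Fin.prod_univ_castSucc`).

References: M. Kontsevich, D. Zagier, *Periods* (2001), §1.2 rules (1)–(3). No definitions are
introduced.
-/

noncomputable section

open MeasureTheory Set
open Literature.NumberTheory.Transcendental Literature.NumberTheory.Transcendental.KZ
open Literature.ModelTheory.ExponentialFields (IsSemialgebraic)

namespace Summit.KontsevichZagierPeriods.HurwitzMicroSectors.NormalFormPrinciple.PiBox.LevelOne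

/-! ### The swap of the last two coordinates -/

/-- The transposition of the last two coordinates of `Fin (w + 2)` fixes the spectator
coordinates `castSucc (castSucc i)`, `i : Fin w`. [folklore] -/
theorem bsd_swap_castSucc_castSucc {w : ℕ} (i : Fin w) :
    Equiv.swap (Fin.castSucc (Fin.last w)) (Fin.last (w + 1)) (Fin.castSucc (Fin.castSucc i)) =
      Fin.castSucc (Fin.castSucc i) :=
  Equiv.swap_apply_of_ne_of_ne
    (fun h => (Fin.castSucc_lt_last i).ne (Fin.castSucc_injective _ h))
    (Fin.castSucc_lt_last _).ne

/-! ### Rational functions on the band -/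

/-- The rational functions `q uᵉ z_last^m sᵇ/(1 − (∏ u) s)` (`u = init (init z)` the spectators,
`s = z (castSucc (last w))`) are `ℚ`-semialgebraic on every `ℚ`-semialgebraic set on which the
denominator does not vanish. [folklore] -/
theorem bsd_isSemialgebraicFunOn_ratFun {w : ℕ} (e : Fin w → ℕ) (q : ℚ) (m b : ℕ)
    {B : Set (Fin (w + 2) → ℝ)} (hB : IsSemialgebraic ℚ B)
    (hden : ∀ z ∈ B,
      (1:ℝ) - (∏ i, Fin.init (Fin.init z) i) * z (Fin.castSucc (Fin.last w)) ≠ 0) :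
    IsSemialgebraicFunOn ℚ B (fun z => (q : ℝ) * ((∏ i, Fin.init (Fin.init z) i ^ e i) *
      (z (Fin.last (w + 1)) ^ m * z (Fin.castSucc (Fin.last w)) ^ b)) /
      (1 - (∏ i, Fin.init (Fin.init z) i) * z (Fin.castSucc (Fin.last w)))) := by
  refine (isSemialgebraicFunOn_aeval_div_aeval hB
    (MvPolynomial.C q * ((∏ i : Fin w, MvPolynomial.X (Fin.castSucc (Fin.castSucc i)) ^ e i) *
      (MvPolynomial.X (Fin.last (w + 1)) ^ m * MvPolynomial.X (Fin.castSucc (Fin.last w)) ^ b)))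
    (1 - (∏ i : Fin w, MvPolynomial.X (Fin.castSucc (Fin.castSucc i))) *
      MvPolynomial.X (Fin.castSucc (Fin.last w))) fun z hz => ?_).congr fun z _ => ?_
  · simpa [map_prod, Fin.init] using hden z hz
  · simp [map_prod, Fin.init]

/-! ### The primitive along the last coordinate -/

/-- The derivative of the primitive `s ↦ (c/(a−b)) P s^{a−b} Q/D` is `c P s^{a−b−1} Q/D`
(`b < a`). [folklore] -/
theorem bsd_hasDerivAt (a b : ℕ) (c : ℚ) (hab : b < a) (P Q D t : ℝ) :
    HasDerivAt (fun s : ℝ => (c : ℝ) / ((a - b : ℕ) : ℝ) * (P * (s ^ (a - b) * Q)) / D)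
      ((c : ℝ) * (P * (t ^ (a - b - 1) * Q)) / D) t := by
  have hne : ((a - b : ℕ) : ℝ) ≠ 0 := Nat.cast_ne_zero.2 (Nat.sub_ne_zero_of_lt hab)
  have h := ((((hasDerivAt_pow (a - b) t).mul_const Q).const_mul P).const_mul
    ((c : ℝ) / ((a - b : ℕ) : ℝ))).div_const D
  refine h.congr_deriv ?_
  field_simp

/-! ### The stub -/

/-- **T3 (integrating out the merged coordinate; registered sub-goal of the level-one box tower of
`stub_boxRigidity`).** For `b < a`, `c ∈ ℚ` and spectator exponents `e : Fin w → ℕ`, the band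
representation `R = [T, c uᵉ y^{a−b−1} z_last^b/(1 − (∏ u) z_last)]`,
`T = {init z ∈ (0,1)^{w+1}, 0 ≤ z_last ≤ y}` (`u = init (init z)`, `y = z (castSucc (last w))`), and
the representation `N₁ = [(0,1)^{w+1}, (c/(a−b)) (init x)ᵉ sᵇ (1 − s^{a−b})/(1 − ∏ x)]`
(`s = x (last w)`) differ by a relation: swap the last two coordinates (rule 2), adjust the two null
hyperplane sections `{s = 0}`, `{z_last = 1}` (rule 1), and make ONE Newton–Leibniz move along
`z_last ∈ [s, 1]` over the base `(0,1)^{w+1}` with the primitive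
`(c/(a−b)) uᵉ z_last^{a−b} sᵇ/(1 − (∏ u) s)` (rule 3).
[cite: KontsevichZagier2001, §1.2 rules (1)–(3)] -/
theorem band_sub_levelOne_dim {w : ℕ} (e : Fin w → ℕ) (a b : ℕ) (c : ℚ) (hab : b < a)
    (R : IntegralRep (w + 2)) (N₁ : IntegralRep (w + 1))
    (hRd : R.domain = KZlog.band {y : Fin (w + 1) → ℝ | ∀ i, y i ∈ Set.Ioo (0:ℝ) 1} (fun _ => (0:ℝ))
        (fun y => y (Fin.last w)))
    (hRi : EqOn R.integrand (fun z => (c : ℝ) * ((∏ i, Fin.init (Fin.init z) i ^ e i) *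
        (z (Fin.castSucc (Fin.last w)) ^ (a - b - 1) * z (Fin.last (w + 1)) ^ b)) /
        (1 - (∏ i, Fin.init (Fin.init z) i) * z (Fin.last (w + 1)))) R.domain)
    (hN₁d : N₁.domain = {x | ∀ i, x i ∈ Set.Ioo (0:ℝ) 1})
    (hN₁i : EqOn N₁.integrand (fun x => (c : ℝ) / ((a - b : ℕ) : ℝ) *
        ((∏ i, Fin.init x i ^ e i) * (x (Fin.last w) ^ b * (1 - x (Fin.last w) ^ (a - b)))) /
        (1 - ∏ i, x i)) N₁.domain) :
    of R - of N₁ ∈ relations := by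
  -- the base `τ = N₁.domain = (0,1)^{w+1}`
  have hτ : IsSemialgebraic ℚ N₁.domain := N₁.isSemialgebraic_domain
  have hmemτ : ∀ x : Fin (w + 1) → ℝ, x ∈ N₁.domain ↔ ∀ i, x i ∈ Set.Ioo (0:ℝ) 1 := fun x => by
    rw [hN₁d]
    rfl
  -- the swap `σ` of the last two coordinates, made opaque
  obtain ⟨σ, hσ₁, hσ₂, hσ₃⟩ : ∃ σ : Equiv.Perm (Fin (w + 2)),
      σ (Fin.castSucc (Fin.last w)) = Fin.last (w + 1) ∧ σ (Fin.last (w + 1)) =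
        Fin.castSucc (Fin.last w) ∧
      ∀ i : Fin w, σ (Fin.castSucc (Fin.castSucc i)) = Fin.castSucc (Fin.castSucc i) :=
    ⟨Equiv.swap _ _, Equiv.swap_apply_left _ _, Equiv.swap_apply_right _ _,
      bsd_swap_castSucc_castSucc⟩
  have hinit₂ : ∀ z : Fin (w + 2) → ℝ,
      Fin.init (Fin.init (fun i => z (σ i))) = Fin.init (Fin.init z) := fun z => by
    funext i
    exact congrArg z (hσ₃ i)
  -- membership in the swapped band and in the upper band `B₂`
  have hmemR' : ∀ z : Fin (w + 2) → ℝ, z ∈ (R.reindex σ).domain ↔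
      ((∀ i : Fin w, z (Fin.castSucc (Fin.castSucc i)) ∈ Set.Ioo (0:ℝ) 1) ∧
        z (Fin.last (w + 1)) ∈ Set.Ioo (0:ℝ) 1) ∧
      0 ≤ z (Fin.castSucc (Fin.last w)) ∧ z (Fin.castSucc (Fin.last w)) ≤ z (Fin.last (w + 1)) :=
    fun z => by
    rw [IntegralRep.reindex_domain, mem_setOf_eq, hRd, KZlog.mem_band, mem_setOf_eq]
    simp only [Fin.forall_fin_succ', Fin.init, hσ₁, hσ₂, hσ₃]
  have hmemB : ∀ z : Fin (w + 2) → ℝ,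
      z ∈ KZlog.band N₁.domain (fun y => y (Fin.last w)) (fun _ => (1:ℝ)) ↔
      (∀ j : Fin (w + 1), z (Fin.castSucc j) ∈ Set.Ioo (0:ℝ) 1) ∧
        z (Fin.castSucc (Fin.last w)) ≤ z (Fin.last (w + 1)) ∧ z (Fin.last (w + 1)) ≤ 1 :=
    fun z => by
    rw [KZlog.mem_band, hmemτ]
    rfl
  -- passing between the two bands off the null hyperplanes
  have hRB : ∀ z ∈ (R.reindex σ).domain, z (Fin.castSucc (Fin.last w)) ≠ 0 →
      z ∈ KZlog.band N₁.domain (fun y => y (Fin.last w)) (fun _ => (1:ℝ)) := fun z hz h0 => by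
    obtain ⟨⟨hsp, hl⟩, hs0, hsl⟩ := (hmemR' z).1 hz
    have hpos : 0 < z (Fin.castSucc (Fin.last w)) := lt_of_le_of_ne hs0 (Ne.symm h0)
    exact (hmemB z).2 ⟨Fin.forall_fin_succ'.2 ⟨hsp, hpos, hsl.trans_lt hl.2⟩, hsl, hl.2.le⟩
  have hBR : ∀ z ∈ KZlog.band N₁.domain (fun y => y (Fin.last w)) (fun _ => (1:ℝ)),
      z (Fin.last (w + 1)) ≠ 1 → z ∈ (R.reindex σ).domain := fun z hz h1 => by
    obtain ⟨hj, hsl, hl1⟩ := (hmemB z).1 hz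
    have hlt : z (Fin.last (w + 1)) < 1 := lt_of_le_of_ne hl1 h1
    exact (hmemR' z).2 ⟨⟨fun i => hj (Fin.castSucc i), (hj (Fin.last w)).1.trans_le hsl, hlt⟩,
      (hj (Fin.last w)).1.le, hsl⟩
  -- the common `ℚ`-semialgebraic set `W`
  obtain ⟨W, hWdef⟩ : ∃ W : Set (Fin (w + 2) → ℝ), W = (R.reindex σ).domain ∩
      KZlog.band N₁.domain (fun y => y (Fin.last w)) (fun _ => (1:ℝ)) := ⟨_, rfl⟩
  have hB₂ : IsSemialgebraic ℚ (KZlog.band N₁.domain (fun y => y (Fin.last w)) (fun _ => (1:ℝ))) :=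
    KZlog.isSemialgebraic_band (isSemialgebraicFunOn_apply hτ (Fin.last w))
      (by simpa using isSemialgebraicFunOn_ratCast hτ 1)
  have hW : IsSemialgebraic ℚ W := hWdef ▸ (R.reindex σ).isSemialgebraic_domain.inter hB₂
  have hWm : MeasurableSet W :=
    Literature.ModelTheory.ExponentialFields.IsSemialgebraic.measurableSet_holds hW
  have hWR' : W ⊆ (R.reindex σ).domain := hWdef ▸ inter_subset_left
  have hWB : W ⊆ KZlog.band N₁.domain (fun y => y (Fin.last w)) (fun _ => (1:ℝ)) :=
    hWdef ▸ inter_subset_right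
  have hvolR' : volume ((R.reindex σ).domain \ W) = 0 := by
    refine measure_mono_null (fun z hz => ?_)
      (Measure.pi_hyperplane (fun _ => (volume : Measure ℝ)) (Fin.castSucc (Fin.last w)) 0)
    by_contra h0
    exact hz.2 (hWdef ▸ ⟨hz.1, hRB z hz.1 h0⟩)
  have hvolB :
      volume (KZlog.band N₁.domain (fun y => y (Fin.last w)) (fun _ => (1:ℝ)) \ W) = 0 := by
    refine measure_mono_null (fun z hz => ?_)
      (Measure.pi_hyperplane (fun _ => (volume : Measure ℝ)) (Fin.last (w + 1)) 1)
    by_contra h1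
    exact hz.2 (hWdef ▸ ⟨hBR z hz.1 h1, hz.1⟩)
  -- the swapped integrand `h`, read off `R` through the swap
  have hRW : ∀ z ∈ (R.reindex σ).domain, (R.reindex σ).integrand z =
      (c : ℝ) * ((∏ i, Fin.init (Fin.init z) i ^ e i) *
        (z (Fin.last (w + 1)) ^ (a - b - 1) * z (Fin.castSucc (Fin.last w)) ^ b)) /
        (1 - (∏ i, Fin.init (Fin.init z) i) * z (Fin.castSucc (Fin.last w))) := fun z hz => by
    have hz' : (fun i => z (σ i)) ∈ R.domain := hz
    rw [IntegralRep.reindex_integrand]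
    show R.integrand (fun i => z (σ i)) = _
    rw [hRi hz']
    simp only [hinit₂ z, hσ₁, hσ₂]
  -- the denominator is positive on the upper band
  have hden : ∀ z ∈ KZlog.band N₁.domain (fun y => y (Fin.last w)) (fun _ => (1:ℝ)),
      (0:ℝ) < 1 - (∏ i, Fin.init (Fin.init z) i) * z (Fin.castSucc (Fin.last w)) := fun z hz => by
    obtain ⟨hj, -, -⟩ := (hmemB z).1 hz
    have hp1 : ∏ i, Fin.init (Fin.init z) i ≤ 1 :=
      Finset.prod_le_one (fun i _ => (hj (Fin.castSucc i)).1.le)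
        fun i _ => (hj (Fin.castSucc i)).2.le
    have hs := hj (Fin.last w)
    exact sub_pos.2 ((mul_le_of_le_one_left hs.1.le hp1).trans_lt hs.2)
  have hden' : ∀ z ∈ KZlog.band N₁.domain (fun y => y (Fin.last w)) (fun _ => (1:ℝ)),
      (1:ℝ) - (∏ i, Fin.init (Fin.init z) i) * z (Fin.castSucc (Fin.last w)) ≠ 0 :=
    fun z hz => (hden z hz).ne'
  -- the upper-band representation `r₂ = [B₂, h]`
  have hh := bsd_isSemialgebraicFunOn_ratFun e c (a - b - 1) b hB₂ hden'
  have hintW : IntegrableOn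
      (fun z : Fin (w + 2) → ℝ => (c : ℝ) * ((∏ i, Fin.init (Fin.init z) i ^ e i) *
        (z (Fin.last (w + 1)) ^ (a - b - 1) * z (Fin.castSucc (Fin.last w)) ^ b)) /
        (1 - (∏ i, Fin.init (Fin.init z) i) * z (Fin.castSucc (Fin.last w)))) W :=
    ((R.reindex σ).integrableOn.mono_set hWR').congr_fun (fun z hz => hRW z (hWR' hz)) hWm
  have hsubB : KZlog.band N₁.domain (fun y => y (Fin.last w)) (fun _ => (1:ℝ)) ⊆
      W ∪ {z | z (Fin.last (w + 1)) = 1} := by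
    intro z hz
    by_cases h1 : z (Fin.last (w + 1)) = 1
    · exact Or.inr h1
    · exact Or.inl (hWdef ▸ ⟨hBR z hz h1, hz⟩)
  have hint : IntegrableOn
      (fun z : Fin (w + 2) → ℝ => (c : ℝ) * ((∏ i, Fin.init (Fin.init z) i ^ e i) *
        (z (Fin.last (w + 1)) ^ (a - b - 1) * z (Fin.castSucc (Fin.last w)) ^ b)) /
        (1 - (∏ i, Fin.init (Fin.init z) i) * z (Fin.castSucc (Fin.last w))))
      (KZlog.band N₁.domain (fun y => y (Fin.last w)) (fun _ => (1:ℝ))) :=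
    (hintW.union (IntegrableOn.of_measure_zero
      (Measure.pi_hyperplane (fun _ => (volume : Measure ℝ)) (Fin.last (w + 1)) 1))).mono_set hsubB
  obtain ⟨r₂, hr₂d, hr₂i⟩ : ∃ r₂ : IntegralRep (w + 2),
      r₂.domain = KZlog.band N₁.domain (fun y => y (Fin.last w)) (fun _ => (1:ℝ)) ∧
      r₂.integrand = fun z => (c : ℝ) * ((∏ i, Fin.init (Fin.init z) i ^ e i) *
        (z (Fin.last (w + 1)) ^ (a - b - 1) * z (Fin.castSucc (Fin.last w)) ^ b)) /
        (1 - (∏ i, Fin.init (Fin.init z) i) * z (Fin.castSucc (Fin.last w))) :=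
    ⟨⟨_, _, hB₂, hh, hint⟩, rfl, rfl⟩
  have hWr₂ : W ⊆ r₂.domain := by
    rw [hr₂d]
    exact hWB
  have hvolr₂ : volume (r₂.domain \ W) = 0 := by
    rw [hr₂d]
    exact hvolB
  -- (1) rule 2: the swap
  have hS := of_sub_of_reindex_mem_relations R σ
  -- (2) rule 1: the two null adjustments and the congruence on `W`
  have hres₁ := IntegralRep.of_sub_of_restrict_mem_relations (R.reindex σ) hW hWR' hvolR'
  have hres₂ := IntegralRep.of_sub_of_restrict_mem_relations r₂ hW hWr₂ hvolr₂
  have hcmp : of ((R.reindex σ).restrict _ hW hWR') - of (r₂.restrict _ hW hWr₂) ∈ relations := by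
    refine of_sub_of_mem_relations_of_eqOn rfl fun z hz => ?_
    show (R.reindex σ).integrand z = r₂.integrand z
    rw [hRW z (hWR' hz), hr₂i]
  -- (3) rule 3: ONE Newton–Leibniz move along `z_last ∈ [s, 1]` over `τ`
  have hNL : of r₂ - of N₁ ∈ relations := by
    refine newtonLeibnizRel_subset_relations ⟨w + 1, r₂, N₁, fun y => y (Fin.last w),
      fun _ => (1:ℝ),
      fun z => (c : ℝ) / ((a - b : ℕ) : ℝ) * ((∏ i, Fin.init (Fin.init z) i ^ e i) *
        (z (Fin.last (w + 1)) ^ (a - b) * z (Fin.castSucc (Fin.last w)) ^ b)) /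
        (1 - (∏ i, Fin.init (Fin.init z) i) * z (Fin.castSucc (Fin.last w))),
      ?_, isSemialgebraicFunOn_apply hτ (Fin.last w),
      (by simpa using isSemialgebraicFunOn_ratCast hτ 1),
      fun x hx => ((hmemτ x).1 hx (Fin.last w)).2.le, ?_, ?_, ?_, ?_, rfl⟩
    · -- the primitive is a quotient of `ℚ`-polynomials on the band
      rw [hr₂d]
      exact (bsd_isSemialgebraicFunOn_ratFun e (c / ((a - b : ℕ) : ℚ)) (a - b) b hB₂ hden').congr
        fun z _ => by rw [Rat.cast_div, Rat.cast_natCast]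
    · -- the band over `τ` with edges `s ≤ z_last ≤ 1`
      rw [hr₂d]
      rfl
    · -- continuity of the primitive on the closed fibre
      intro x _
      simp only [Fin.init_snoc, Fin.snoc_last, Fin.snoc_castSucc]
      exact Continuous.continuousOn (by fun_prop)
    · -- its derivative on the open fibre is the integrand
      intro x _ t _
      rw [hr₂i]
      simp only [Fin.init_snoc, Fin.snoc_last, Fin.snoc_castSucc]
      exact bsd_hasDerivAt a b c hab _ _ _ t
    · -- the endpoint difference
      intro x hx
      rw [hN₁i hx]
      simp only [Fin.init_snoc, Fin.snoc_last, Fin.snoc_castSucc, one_pow, Fin.prod_univ_castSucc]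
      simp only [Fin.init]
      ring
  -- (4) bookkeeping
  have key : of R - of N₁ = (of R - of (R.reindex σ)) +
      (of (R.reindex σ) - of ((R.reindex σ).restrict _ hW hWR')) +
      (of ((R.reindex σ).restrict _ hW hWR') - of (r₂.restrict _ hW hWr₂)) -
      (of r₂ - of (r₂.restrict _ hW hWr₂)) + (of r₂ - of N₁) := by
    abel
  rw [key]
  exact relations.add_mem (relations.sub_mem (relations.add_mem (relations.add_mem hS hres₁) hcmp)
    hres₂) hNL

end Summit.KontsevichZagierPeriods.HurwitzMicroSectors.NormalFormPrinciple.PiBox.LevelOne
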